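import Literature.Claims.NS.Chae2007
import Literature.Analysis.FluidPDE.CriticalSpaces
import Literature.Analysis.FluidPDE.LerayHopf
import Mathlib.Analysis.Distribution.Sobolev
import Literature.Analysis.FunctionSpaces.FourierSobolevSupBound
import Literature.Analysis.FluidPDE.NSWeakStrongUniquenessHolds
import HarnessLib

/-!
# Claim skeleton C152 `PinheiroQueiroz2025` — Marcio Pinheiro Queiroz, «Functional and Spectral
# Resolution of the 3D Navier–Stokes Problem: A Fully Expanded Mathematical Proof of Global Regularity
# and Impossibility of Blow-Up» (Zenodo record 15702037, concept 15702036, created 2025-06-20, printed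
# «June 2025»; «CLAY_NAVIER-final.pdf», 14 pp.)

Cell `ns-claims` (D-0090 NS-CLAIMS SWEEP), claim C152 (RULINGS v1.36 (3), tail tranche 3 row A14), typist
`ns-claims-typist-4` (g5); refuter of record `ns-claims-refuter-1` (g4), second `ns-claims-refuter-6`;
referee lane 4; salvage `ns-claims-salvage-p6`. UNREFEREED / DISPUTED CLAIM under adjudication —
**nothing in this file asserts a step**: the claimed statement and every step are `Prop`-valued definitions;
the `theorem`s are the kernel COMPOSITION of the paper's own chain, the Clay link, a bound on the printed
majorant (`majorant_le_max`, real arithmetic), the arithmetic of the printed §5.4 implication evaluated at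
one point (`s54_at_zero`, recorded next to `Step_S54`, no verdict) and a sufficient condition for the printed
data class (`isDatum_of_hasCompactSupport`, from Mathlib's `SchwartzMap.memSobolev`).

TEXT OF RECORD: census pin `pub/ns-claims/census/texts/PinheiroQueiroz2025/zenodo-15702037.pdf` (staging
README b175a11ec277ce30) = `pub/ns-claims/sources/PinheiroQueiroz2025/PinheiroQueiroz2025_zenodo15702037.pdf`,
PDF sha16 1a14f6f5bcc3c876, ONE version; PDF page = printed page; line numbers are those of
`sources/PinheiroQueiroz2025/pages/pNNN.txt` (LOCATORS.md, ns-claims-lit-2 g5 pre-sourced v1 / ns-claims-lit-1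
g9 SOURCED lane). Bib key `PinheiroQueiroz2025` (doi 10.5281/zenodo.15702037).

## What the text contains (LOCATORS §1, checked on the pages)

Equations (1)–(3) p.3 l.25–33 (unforced Navier–Stokes on `ℝ³`, `ν > 0`); data «v₀ ∈ H^s(ℝ³) with s > 5/2»,
class «U = C([0,T);H^s) ∩ L²_loc([0,T);H^{s+1})» (§3.2 p.3 l.34–48); blow-up criterion §3.3 p.3 l.49–59.
Theorem-like items are UNNUMBERED bracket-labelled statements; the main theorem is §10.2 p.12 l.19–40
«[Global Regularity of the 3D Incompressible Navier–Stokes Equations]» (= §9.5 p.11 l.34–47 items 1–2),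
typed as `ClaimedTheorem`. Printed chain (§10.1 p.11–12 «five structural pillars»): `L²` energy identity
§4 p.4 → Littlewood–Paley heuristics §5 p.5–6 (with the arithmetic «−2s + 1 < 2 ⟹ s > 5/2» p.6 l.23–27)
→ the `H^s` inequality §6.3 p.7 l.1–10 «d/dt‖v‖²_{H^s} + 2ν‖v‖²_{H^{s+1}} ≤ C‖v‖³_{H^s}» → §6.4 p.7
l.11–21 «Riccati ODE Model … dy/dt ≤ −By + Ay^{3/2}, where A, B > 0 are constants depending on ν and
Sobolev constants» → §6.5 p.7 l.22–32 «The solution to the Riccati-type inequality behaves as: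
y(t) ≤ y(0)B/((B − Ay(0))e^{−Bt} + Ay(0)). As t → ∞: y(t) → B/A. This is a bounded steady state» → §6.6
p.7 l.33–35 «Dissipation enforces boundedness of the H^s norm for all t ≥ 0, with no possibility of
finite-time blow-up» → §9.5/§10.2. §7 p.7–8 «[Instant Regularization]» (every Leray weak solution is in
`H^s` for every `s` at every `t > 0`), §8 p.8–10 and §9.1–9.4 p.10–11 («functional collapse», «the
equations lose mathematical definition») are off the Final Theorem's path, which starts from `H^s` data
(REF ref-4 g5 10:46:59Z flags (d)(e)); §8/§9.4 and §9.5 item 3 are not propositions and are not typed.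

## How it is typed

* Data class: §10.1 p.11 l.56–61 «classical smooth initial data v₀ ∈ H^s(R³) with s > 5/2 and ∇·v₀ = 0»
  (abstract p.1 l.9 «smooth initial data»; §3.2, §9.5, §10.2 «v₀ ∈ H^s(R³) with s > 5/2») — `IsDatum s v₀`
  = smooth ∧ divergence-free ∧ `InHs s v₀`, the last through Mathlib's Bessel-potential Sobolev space
  (`TemperedDistribution.MemSobolev s 2`) of the tempered distribution of `v₀` (tree predicate
  `IsDistributionOf`; same device as the C143 skeleton `Guevremont2026.InHs` —
  TODO(refactor): a shared `Literature` home for this predicate). Every `C_c^∞` divergence-free field is a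
  datum for every `s` (`isDatum_of_hasCompactSupport`).
* Solutions: the tree's classical (jointly `C^∞`) unforced solutions with `v(0) = v₀`, on `[0,T)` or
  `[0,∞)`, together with the printed class `U` rendered on the `H^s` NORM: `t ↦ ‖v(t)‖_{H^s}` finite and
  continuous on the interval and `‖v‖_{H^{s+1}}` square-integrable on compact sub-intervals (`InU`), the
  norms being the tree's Fourier-side `Function.eSobolevNorm` of the complexified slice (junk `∞` off `L²`;
  finiteness is asserted where the print displays the norm as a number). For smooth `H^s` data the printed
  `H^s` solution is smooth, so the classical rendering loses nothing the chain uses (pattern C07 `Chae2007`).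
* The constants `C` (§6.3), `A, B` (§6.4: «depending on ν and Sobolev constants») are carried as a
  parameter `K : Constants` (functions of `(ν, s)` with the printed positivity), one `K` for all data and
  solutions — pattern `N : Substrate` (C102) / `R : Resolution` (C143).
* `y(t) = ‖v(t)‖²_{H^s}` (§6.4 p.7 l.12–15) is `ySq s v t`; the §6.5 majorant is `majorant A B y₀ t`.

## Clay delta (reference `Literature.Claims.NS.ClayVariants`, axes of its §3; LOCATORS §2)

Direction REGULARITY (POS); nearest Clay statement (A) = `ClayVariants.clayR3.Regularity`. Δ1 `ℝ³` = ·
Δ2 (1)–(2) unforced, `ν > 0` = · Δ3 none = · **Δ4 data `H^s ∩ C^∞`, `s > 5/2`, divergence-free — WIDER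
than Clay's class (4); the inclusion (4) ⊂ H^s (Schwartz fields) is classical and is carried as the
explicit hypothesis `ClayDelta` (pattern C04b/C143)** · Δ5 conclusion: global `v ∈ U` with
`sup_t ‖v(t)‖_{H^s} < ∞` and «unique» — no pressure statement, no energy bound (7) in the theorem; (6)
holds by the classical rendering; (7) is supplied by the printed energy identity §4.1 (Step 0, binder of
the Clay link); uniqueness is typed separately (`ClaimedUniqueness`, not consumed) · Δ6 constants `A, B, C`
of (ν, s); threshold `s > 5/2` · Δ7 `ν > 0` arbitrary = .
`clay_of_claimed : ClaimedTheorem → Step0_Energy → ClayDelta → clayR3.Regularity` PROVED.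

## Step index (dependency order = argument order of `claim_of_steps`)

* Step 0 = `Step0_Energy` — §4.1 p.4 l.47–67: the energy identity (TRUE-type; Clay link only).
* Step S54 = `Step_S54` — §5.4 p.6 l.23–27 «−2s + 1 < 2 ⟹ s > 5/2» AS PRINTED (decorative arithmetic, off
  path; REF flag (c)).
* Step 1 = `Step1_LWP` — §3.2–3.3 p.3 l.34–59: local theory + blow-up alternative in `U` (implicit/classical).
* Step 2 = `Step2_HsIneq K` — §6.3 p.7 l.1–10: the `H^s` energy inequality (classical; support of Step 3).
* Step 3 = `Step3_Riccati K` — §6.4 p.7 l.11–21: `y′ ≤ −By + Ay^{3/2}` along solutions (LOAD-BEARING as the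
  hypothesis Step 4 consumes).
* Step 4 = `Step4_Majorant K` — §6.5 p.7 l.22–32: every non-negative solution of the Riccati inequality
  lies below the printed majorant — LOAD-BEARING (function grain).
* Step 7 = `Step7_InstantReg` — §7 p.7 l.37–52 (recorded; off path; summit-strength).
* §6.6 / §9.5 (2): bounded `H^s` norm ⇒ no blow-up — bookkeeping through Step 1, proved inline.

WHAT THIS IS NOT: not a claim about NS regularity or blow-up; not a claim about any author beyond the typed
locator.
-/

open scoped ContDiff ENNReal NNReal Topology InnerProductSpace RealInnerProductSpace SchwartzMap
open _root_.MeasureTheory _root_.Set _root_.Filter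

namespace Literature.Claims.NS.PinheiroQueiroz2025

open Literature.Analysis.FluidPDE

noncomputable section

/-- `ℝ³` (plumbing abbreviation). [folklore] -/
abbrev E3 : Type := EuclideanSpace ℝ (Fin 3)

/-- `ℂ³`, carrier of the Fourier-side norms (plumbing abbreviation). [folklore] -/
abbrev C3 : Type := EuclideanSpace ℂ (Fin 3)

/-! ## A. Data, norms, solution class -/

/-- `v₀ ∈ H^s(ℝ³)` (§3.2 p.3 l.35–39; §10.2 p.12 l.20–25): the tempered distribution of `v₀` (tree predicate
`IsDistributionOf`) lies in Mathlib's Sobolev space `H^s = H^{s,2}(ℝ³)` (`TemperedDistribution.MemSobolev s 2`).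
Same predicate as the C143 skeleton's `Guevremont2026.InHs`. [cite: PinheiroQueiroz2025, §3.2 p.3 l.34–48] -/
def InHs (s : ℝ) (v₀ : E3 → E3) : Prop :=
  ∃ U : 𝓢'(E3, C3), IsDistributionOf v₀ U ∧ TemperedDistribution.MemSobolev s 2 U

/-- The printed data class: «classical smooth initial data v₀ ∈ H^s(R³) with s > 5/2 and ∇·v₀ = 0»
(§10.1 p.11 l.56–61; §3.2 p.3 l.35–39; abstract p.1 l.9), at Sobolev index `s` (the claim takes `s > 5/2`).
[cite: PinheiroQueiroz2025, §10.1 p.11 l.56–61; §3.2 p.3 l.34–39] -/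
def IsDatum (s : ℝ) (v₀ : E3 → E3) : Prop :=
  ContDiff ℝ ∞ v₀ ∧ VectorCalculus.IsDivFree v₀ ∧ InHs s v₀

/-- `‖w‖_{H^r}` of a (real) field slice, in `[0,∞]`: the tree's Fourier-side inhomogeneous Sobolev norm of
the complexified field (`∞` off `L²`). [cite: PinheiroQueiroz2025, §3.2 p.3 l.41–47; §6.4 p.7 l.12–15] -/
def hsE (r : ℝ) (w : E3 → E3) : ℝ≥0∞ :=
  Function.eSobolevNorm r (Literature.Analysis.FunctionSpaces.EuclideanSpace.complexify ∘ w)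

/-- `y(t) = ‖v(t)‖²_{H^s}` (§6.4 p.7 l.12–15) as a real number along a velocity field (`0` where the norm
is infinite — the steps that display `y` state its finiteness). [cite: PinheiroQueiroz2025, §6.4 p.7 l.12–15] -/
def ySq (s : ℝ) (v : ℝ → E3 → E3) (t : ℝ) : ℝ := (hsE s (v t)).toReal ^ 2

/-- Membership in the printed class `U = C(I; H^s) ∩ L²_loc(I; H^{s+1})` (§3.2 p.3 l.41–47), RENDERED on the
norms: `‖v(t)‖_{H^s}` finite and continuous on the time set `S`, and `‖v‖²_{H^{s+1}}` integrable on every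
`[0,T'] ⊆ S`. [cite: PinheiroQueiroz2025, §3.2 p.3 l.41–47] -/
def InU (s : ℝ) (S : Set ℝ) (v : ℝ → E3 → E3) : Prop :=
  (∀ t ∈ S, hsE s (v t) < ⊤) ∧ ContinuousOn (fun t => (hsE s (v t)).toReal) S ∧
    ∀ T' : ℝ, 0 < T' → Icc 0 T' ⊆ S → (∫⁻ t in Ioo 0 T', hsE (s + 1) (v t) ^ 2) < ⊤

/-- A solution of (1)–(3) on the time set `S` (`S = [0,T)` or `[0,∞)`) in the class `U` from `v₀`
(§3.1–3.2 p.3 l.24–48): the tree's classical unforced solution with viscosity `ν` (jointly smooth `v`, `p`),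
`v(0) = v₀`, and `InU`. [cite: PinheiroQueiroz2025, §3.1–3.2 p.3 l.24–48] -/
structure IsSolutionOn (ν s : ℝ) (S : Set ℝ) (v₀ : E3 → E3) (v : ℝ → E3 → E3) (p : ℝ → E3 → ℝ) :
    Prop where
  /-- (1)–(2) hold classically on `ℝ³ × S`, `v`, `p` jointly smooth. -/
  isClassical : IsClassicalNSSolutionOn S ν 0 v p
  /-- (3): `v(·,0) = v₀`. -/
  initial : v 0 = v₀
  /-- `v ∈ U` on `S` (§3.2). -/
  inU : InU s S v

/-- The constants the text leaves as «constants depending on ν and Sobolev constants»: `C` of §6.3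
(Kato–Ponce + Sobolev; a function of `s`), `A, B > 0` of §6.4 (functions of `(ν, s)`), with the printed
positivity. Carried as parameters; nothing about them is asserted here.
[cite: PinheiroQueiroz2025, §6.2–6.4 p.6 l.57–73, p.7 l.1–21] -/
structure Constants where
  /-- `C` of §6.3 as a function of `s`. -/
  C : ℝ → ℝ
  /-- `A` of §6.4 as a function of `(ν, s)`. -/
  A : ℝ → ℝ → ℝ
  /-- `B` of §6.4 as a function of `(ν, s)`. -/
  B : ℝ → ℝ → ℝ
  /-- «A, B > 0» (p.7 l.20). -/
  A_pos : ∀ ν s, 0 < ν → 5 / 2 < s → 0 < A ν s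
  /-- «A, B > 0» (p.7 l.20). -/
  B_pos : ∀ ν s, 0 < ν → 5 / 2 < s → 0 < B ν s

/-- The printed majorant of §6.5 p.7 l.24–26, `y(0)B/((B − Ay(0))e^{−Bt} + Ay(0))`.
[cite: PinheiroQueiroz2025, §6.5 p.7 l.22–31] -/
def majorant (A B y₀ t : ℝ) : ℝ := y₀ * B / ((B - A * y₀) * Real.exp (-B * t) + A * y₀)

/-! ## B. The claimed statement -/

/-- **CLAIMED THEOREM = §10.2 p.12 l.19–33 «[Global Regularity of the 3D Incompressible Navier–Stokes
Equations]»** (= §9.5 p.11 l.34–47 items 1–2): «Let v₀ ∈ H^s(R³) with s > 5/2 and ∇·v₀ = 0. Then the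
incompressible Navier–Stokes equations admit a unique global solution: v ∈ C([0,∞);H^s) ∩ L²_loc([0,∞);
H^{s+1}) such that: sup_{t≥0} ‖v(t)‖_{H^s} < ∞.» Typed for every `ν > 0` (p.3 l.32–33), every `s > 5/2` and
every datum of the class (smooth, §10.1): existence of a global solution in `U` with the uniform `H^s`
bound. «Unique» is `ClaimedUniqueness`; the «Furthermore» bullets (p.12 l.34–40) and §9.5 item 3 are
commentary, not typed. [claim: PinheiroQueiroz2025, status: disputed]
[cite: PinheiroQueiroz2025, §10.2 p.12 l.19–40; §9.5 p.11 l.34–47] -/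
def ClaimedTheorem : Prop :=
  ∀ ν : ℝ, 0 < ν → ∀ s : ℝ, 5 / 2 < s → ∀ v₀ : E3 → E3, IsDatum s v₀ →
    ∃ (v : ℝ → E3 → E3) (p : ℝ → E3 → ℝ), IsSolutionOn ν s (Ici 0) v₀ v p ∧
      (⨆ t ∈ Ici (0 : ℝ), hsE s (v t)) < ⊤

/-- The word «unique» of §10.2 p.12 l.25 / §9.5 item 1, AS PRINTED for the class `U`: two global
solutions in `U` from the same datum have the same velocity. Not argued in the text and not consumed by
the chain; typist's flag: TRUE-type (classical uniqueness of `H^s`-strong solutions, `s > 5/2`).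
[claim: PinheiroQueiroz2025, status: disputed] [cite: PinheiroQueiroz2025, §10.2 p.12 l.25–29] -/
def ClaimedUniqueness : Prop :=
  ∀ ν : ℝ, 0 < ν → ∀ s : ℝ, 5 / 2 < s → ∀ v₀ : E3 → E3, IsDatum s v₀ →
    ∀ (v v' : ℝ → E3 → E3) (p p' : ℝ → E3 → ℝ),
      IsSolutionOn ν s (Ici 0) v₀ v p → IsSolutionOn ν s (Ici 0) v₀ v' p' → ∀ t : ℝ, 0 ≤ t → v t = v' t

/-! ## C. The steps -/

/-- **Step 0 — the energy identity §4.1 p.4 l.47–67** («‖v(t)‖²_{L²} + 2ν∫₀ᵗ‖∇v(τ)‖²_{L²}dτ = ‖v(0)‖²_{L²}»),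
along every solution of the class on `[0,T)`, in `[0,∞]` (`|∇v|²` the Frobenius square of `Dv`). Consumed
only by the Clay link (it supplies Fefferman's (7)). Typist's flag: TRUE-type (classical for `H^s`-strong
solutions, `s > 5/2`; tree: energy equality in Tao's class); not on the regularity chain.
[claim: PinheiroQueiroz2025, status: disputed] [cite: PinheiroQueiroz2025, §4–4.1 p.4 l.1–67] -/
def Step0_Energy : Prop :=
  ∀ ν : ℝ, 0 < ν → ∀ s : ℝ, 5 / 2 < s → ∀ (T : ℝ) (v₀ : E3 → E3) (v : ℝ → E3 → E3) (p : ℝ → E3 → ℝ),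
    IsDatum s v₀ → IsSolutionOn ν s (Ico 0 T) v₀ v p → ∀ t ∈ Ico 0 T,
      (∫⁻ x, ‖v t x‖ₑ ^ 2) +
          ENNReal.ofReal (2 * ν) * ∫⁻ τ in Ioo 0 t, ∫⁻ x, ENNReal.ofReal (frobeniusNormSq (fderiv ℝ (v τ) x)) =
        ∫⁻ x, ‖v₀ x‖ₑ ^ 2

/-- **Step S54 — §5.4 p.6 l.23–27, AS PRINTED**: «For full dissipation dominance relative to the growth of
the dissipation operator, require: −2s + 1 < 2 ⟹ s > 5/2.» A kernel-decidable arithmetic implication,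
DECORATIVE (the threshold `s > 5/2` is a hypothesis of the theorem, not derived from this line; REF ref-4
g5 flag (c)) — typed off the composition path; `s54_at_zero` below evaluates it at one point, no verdict
drawn here. [claim: PinheiroQueiroz2025, status: disputed] [cite: PinheiroQueiroz2025, §5.4 p.6 l.23–27] -/
def Step_S54 : Prop :=
  ∀ s : ℝ, -2 * s + 1 < 2 → 5 / 2 < s

/-- **Step 1 — the local theory in `U` and the blow-up criterion §3.2–3.3 p.3 l.34–59** («we seek solutions
in the functional space U …»; «A solution exhibits finite-time blow-up at time T if lim sup_{t→T⁻}
‖∇v(t)‖_{L∞} = ∞. By Sobolev embedding, for s > 5/2, the condition is equivalent to lim sup_{t→T⁻}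
‖v(t)‖_{H^s} = ∞»), in the form the chain uses them: from every datum of the class EITHER a global
solution in `U` exists OR there are `T* > 0` and a solution in `U` on `[0,T*)` whose `H^s` norm is unbounded
on `[0,T*)`. Typist's flag: classical (Kato's `H^s` theory, `s > 5/2`, with the continuation criterion);
implicit in the text; not a tree theorem at this grain. [claim: PinheiroQueiroz2025, status: disputed]
[cite: PinheiroQueiroz2025, §3.2–3.3 p.3 l.34–59] -/
def Step1_LWP : Prop :=
  ∀ ν : ℝ, 0 < ν → ∀ s : ℝ, 5 / 2 < s → ∀ v₀ : E3 → E3, IsDatum s v₀ →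
    (∃ (v : ℝ → E3 → E3) (p : ℝ → E3 → ℝ), IsSolutionOn ν s (Ici 0) v₀ v p) ∨
    ∃ Ts : ℝ, 0 < Ts ∧ ∃ (v : ℝ → E3 → E3) (p : ℝ → E3 → ℝ),
      IsSolutionOn ν s (Ico 0 Ts) v₀ v p ∧ ∀ M : ℝ, ∃ t ∈ Ico 0 Ts, M < (hsE s (v t)).toReal

/-- **Step 2 — the `H^s` differential inequality §6.3 p.7 l.1–10** («d/dt‖v‖²_{H^s} + 2ν‖v‖²_{H^{s+1}} ≤
C‖v‖³_{H^s}», from §6.1 `Λ^s`-energy identity and §6.2 Kato–Ponce + Sobolev, p.6 l.39–73): along every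
solution of the class on `[0,T)` from a datum, `y = ‖v‖²_{H^s}` is differentiable on `(0,T)` and the
display holds there with the constant `K.C s`. Printed SUPPORT of Step 3 («The inequality simplifies
to»). Typist's flag: classical / TRUE-type (Kato–Ponce commutator estimate, `s > 5/2`).
[claim: PinheiroQueiroz2025, status: disputed] [cite: PinheiroQueiroz2025, §6.1–6.3 p.6 l.39–73, p.7 l.1–10] -/
def Step2_HsIneq (K : Constants) : Prop :=
  ∀ ν : ℝ, 0 < ν → ∀ s : ℝ, 5 / 2 < s → ∀ (T : ℝ) (v₀ : E3 → E3) (v : ℝ → E3 → E3) (p : ℝ → E3 → ℝ),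
    IsDatum s v₀ → IsSolutionOn ν s (Ico 0 T) v₀ v p → ∀ t ∈ Ioo 0 T,
      hsE (s + 1) (v t) < ⊤ ∧ DifferentiableAt ℝ (ySq s v) t ∧
        deriv (ySq s v) t + 2 * ν * (hsE (s + 1) (v t)).toReal ^ 2 ≤
          K.C s * (hsE s (v t)).toReal ^ 3

/-- **Step 3 — the «Riccati ODE Model» §6.4 p.7 l.11–21** («Set: y(t) = ‖v(t)‖²_{H^s}. The inequality
simplifies to: dy/dt ≤ −By + Ay^{3/2}, where A, B > 0 are constants depending on ν and Sobolev
constants.»): along every solution of the class on `[0,T)` from a datum, `y` is continuous on `[0,T)`,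
differentiable on `(0,T)`, and `y′ ≤ −B y + A y^{3/2}` there (`y^{3/2} = y·√y`), with `A = K.A ν s`,
`B = K.B ν s`. The hypothesis Step 4 consumes. Typist's flag: TRUE-type given Step 2 (`‖v‖_{H^{s+1}} ≥
‖v‖_{H^s}` for the inhomogeneous norm; `B = 2ν`, `A = C`). [claim: PinheiroQueiroz2025, status: disputed]
[cite: PinheiroQueiroz2025, §6.4 p.7 l.11–21] -/
def Step3_Riccati (K : Constants) : Prop :=
  ∀ ν : ℝ, 0 < ν → ∀ s : ℝ, 5 / 2 < s → ∀ (T : ℝ) (v₀ : E3 → E3) (v : ℝ → E3 → E3) (p : ℝ → E3 → ℝ),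
    IsDatum s v₀ → IsSolutionOn ν s (Ico 0 T) v₀ v p →
      ContinuousOn (ySq s v) (Ico 0 T) ∧ ∀ t ∈ Ioo 0 T, DifferentiableAt ℝ (ySq s v) t ∧
        deriv (ySq s v) t ≤ -K.B ν s * ySq s v t + K.A ν s * (ySq s v t * Real.sqrt (ySq s v t))

/-- **Step 4 — «Solution Behavior» §6.5 p.7 l.22–32, LOAD-BEARING**: «The solution to the Riccati-type
inequality behaves as: y(t) ≤ y(0)B/((B − Ay(0))e^{−Bt} + Ay(0)). As t → ∞: y(t) → B/A. This is a bounded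
steady state governed by dissipation overcoming nonlinearity.» Typed AS PRINTED at the function grain (REF
ref-4 g5 flag (b)): for the constants `A = K.A ν s`, `B = K.B ν s`, every non-negative `y`, continuous on
`[0,T)`, differentiable on `(0,T)` with `y′ ≤ −By + Ay^{3/2}` there, lies below the printed majorant on
`[0,T)`. Typist's flag: suspicious / predicted locator — no condition relating `y(0)` to `B/A` is printed,
and the displayed closed form is the one of the logistic right side `−By + Ay²` (LOCATORS §4); the chair's
ruling notes that a Riccati UPPER bound with a superlinear positive term does not by itself bound `y`.
[claim: PinheiroQueiroz2025, status: disputed] [cite: PinheiroQueiroz2025, §6.5 p.7 l.22–32] -/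
def Step4_Majorant (K : Constants) : Prop :=
  ∀ ν : ℝ, 0 < ν → ∀ s : ℝ, 5 / 2 < s → ∀ (y : ℝ → ℝ) (T : ℝ), ContinuousOn y (Ico 0 T) →
    (∀ t ∈ Ico 0 T, 0 ≤ y t) →
    (∀ t ∈ Ioo 0 T, DifferentiableAt ℝ y t ∧
      deriv y t ≤ -K.B ν s * y t + K.A ν s * (y t * Real.sqrt (y t))) →
    ∀ t ∈ Ico 0 T, y t ≤ majorant (K.A ν s) (K.B ν s) (y 0) t

/-- **Step 7 — «[Instant Regularization]» §7 p.7 l.37–52** («Let v(x,t) be a Leray weak solution with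
divergence-free initial data v₀ ∈ L²(R³). Then, for any t > 0 and any Sobolev exponent s ≥ 0, v(t) ∈
H^s(R³)»; printed proof p.7 l.53–66, p.8 l.1–5, four sentences). Typed for the tree's (unforced)
Leray–Hopf solutions on `ℝ³ × [0,T)` (`IsLerayHopfOn T ν 0 v₀ v`). RECORDED, off the Final Theorem's path (which starts from `H^s` data; REF
flag (d)); typist's flag: summit-strength (it asserts the smoothing of every Leray–Hopf solution at every
positive time). [claim: PinheiroQueiroz2025, status: disputed] [cite: PinheiroQueiroz2025, §7 p.7 l.37–66, p.8 l.1–10] -/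
def Step7_InstantReg : Prop :=
  ∀ ν : ℝ, 0 < ν → ∀ (T : ℝ) (v₀ : E3 → E3) (v : ℝ → E3 → E3), 0 < T →
    IsLerayHopfOn T ν 0 v₀ v → ∀ t ∈ Ioo 0 T, ∀ s : ℝ, 0 ≤ s → InHs s (v t)

/-- **The Clay delta Δ4 as an explicit hypothesis** (pattern C04b / C143): Fefferman's data class (4) —
smooth, divergence-free, rapidly decaying with all derivatives — lies inside the printed class at the index
`s = 3 > 5/2` (Schwartz fields lie in every `H^s`), and has finite energy. Classical; carried as a
hypothesis of the Clay link, not asserted (the tree has the inclusion only for bundled Schwartz maps;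
`isDatum_of_hasCompactSupport` covers `C_c^∞`). [cite: FeffermanClay2006, (4) p.1]
[cite: BahouriCheminDanchin2011, §1.4.1] -/
def ClayDelta : Prop :=
  ∀ v₀ : E3 → E3, ContDiff ℝ ∞ v₀ → VectorCalculus.IsDivFree v₀ → HasRapidSpatialDecay v₀ →
    IsDatum 3 v₀ ∧ (∫⁻ x, ‖v₀ x‖ₑ ^ 2) < ⊤

/-! ## D. Kernel facts about the typed objects -/

/-- The printed implication of §5.4 evaluated at `s = 0`: its antecedent `−2·0 + 1 < 2` holds and its
consequent `5/2 < 0` fails (arithmetic; recorded next to `Step_S54`, which is off the chain — no verdict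
drawn here). [cite: PinheiroQueiroz2025, §5.4 p.6 l.23–27] -/
theorem s54_at_zero : (-2 * (0 : ℝ) + 1 < 2) ∧ ¬ (5 / 2 < (0 : ℝ)) := by
  constructor <;> norm_num

/-- **The printed majorant is bounded by `max(y(0), B/A)`** for `A, B > 0`, `y(0) ≥ 0`, `t ≥ 0` (real
arithmetic: if `Ay(0) ≤ B` the denominator is at least `Ay(0)`, otherwise at least `B`). This is the
«bounded steady state» reading of §6.5–6.6 used by the composition. [cite: PinheiroQueiroz2025, §6.5–6.6 p.7 l.22–35] -/
theorem majorant_le_max {A B y₀ t : ℝ} (hA : 0 < A) (hB : 0 < B) (hy : 0 ≤ y₀) (ht : 0 ≤ t) :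
    majorant A B y₀ t ≤ max y₀ (B / A) := by
  unfold majorant
  have hexp0 : 0 < Real.exp (-B * t) := Real.exp_pos _
  have hexp1 : Real.exp (-B * t) ≤ 1 := by
    rw [Real.exp_le_one_iff]; nlinarith
  rcases eq_or_lt_of_le hy with hy0 | hy0
  · -- `y₀ = 0`
    subst hy0
    simp only [mul_zero, zero_mul, sub_zero, add_zero, zero_div]
    exact le_max_of_le_left le_rfl
  rcases le_or_gt (A * y₀) B with hle | hgt
  · -- `A y₀ ≤ B`: denominator ≥ A y₀ > 0, so the majorant is ≤ B/A
    have hden : A * y₀ ≤ (B - A * y₀) * Real.exp (-B * t) + A * y₀ := by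
      have : 0 ≤ (B - A * y₀) * Real.exp (-B * t) := mul_nonneg (by linarith) hexp0.le
      linarith
    have hdenpos : 0 < (B - A * y₀) * Real.exp (-B * t) + A * y₀ :=
      lt_of_lt_of_le (mul_pos hA hy0) hden
    refine le_max_of_le_right ?_
    rw [div_le_div_iff₀ hdenpos hA]
    calc y₀ * B * A = B * (A * y₀) := by ring
      _ ≤ B * ((B - A * y₀) * Real.exp (-B * t) + A * y₀) :=
          mul_le_mul_of_nonneg_left hden hB.le
  · -- `A y₀ > B`: denominator ≥ B > 0, so the majorant is ≤ y₀
    have hden : B ≤ (B - A * y₀) * Real.exp (-B * t) + A * y₀ := by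
      have : (B - A * y₀) * 1 ≤ (B - A * y₀) * Real.exp (-B * t) :=
        mul_le_mul_of_nonpos_left hexp1 (by linarith)
      linarith
    have hdenpos : 0 < (B - A * y₀) * Real.exp (-B * t) + A * y₀ := lt_of_lt_of_le hB hden
    refine le_max_of_le_left ?_
    rw [div_le_iff₀ hdenpos]
    calc y₀ * B ≤ y₀ * ((B - A * y₀) * Real.exp (-B * t) + A * y₀) :=
          mul_le_mul_of_nonneg_left hden hy
      _ = y₀ * ((B - A * y₀) * Real.exp (-B * t) + A * y₀) := rfl

/-- **A sufficient condition for the printed data class** (same lemma as the C143 skeleton's): every smooth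
compactly supported field lies in `H^s(ℝ³)` for every `s` — its tempered distribution is that of the
Schwartz map `complexify ∘ v₀`, and Schwartz maps lie in every Sobolev space (Mathlib
`SchwartzMap.memSobolev`). [cite: PinheiroQueiroz2025, §3.2 p.3 l.34–39] [cite: BahouriCheminDanchin2011, §1.4.1] -/
theorem inHs_of_hasCompactSupport {v₀ : E3 → E3} (hs : ContDiff ℝ ∞ v₀) (hc : HasCompactSupport v₀)
    (s : ℝ) : InHs s v₀ := by
  have hgs : ContDiff ℝ ∞ (Literature.Analysis.FunctionSpaces.EuclideanSpace.complexify ∘ v₀) :=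
    Literature.Analysis.FunctionSpaces.EuclideanSpace.contDiff_complexify_comp_iff.2 hs
  have hgc : HasCompactSupport (Literature.Analysis.FunctionSpaces.EuclideanSpace.complexify ∘ v₀) :=
    hc.comp_left (map_zero Literature.Analysis.FunctionSpaces.EuclideanSpace.complexify)
  refine ⟨((hgc.toSchwartzMap hgs : 𝓢(E3, C3)) : 𝓢'(E3, C3)), fun φ => ⟨?_, ?_⟩,
    (hgc.toSchwartzMap hgs).memSobolev⟩
  · have hφg : HasCompactSupport
        ((φ : E3 → ℂ) • (Literature.Analysis.FunctionSpaces.EuclideanSpace.complexify ∘ v₀)) :=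
      hgc.smul_left
    exact (φ.continuous.smul hgs.continuous).integrable_of_hasCompactSupport hφg
  · rw [SchwartzMap.coe_apply]
    rfl

/-- A compactly supported smooth divergence-free field is a datum of the printed class at every index `s`.
[cite: PinheiroQueiroz2025, §3.2 p.3 l.34–39; §10.1 p.11 l.56–61] -/
theorem isDatum_of_hasCompactSupport {v₀ : E3 → E3} (hs : ContDiff ℝ ∞ v₀)
    (hdiv : VectorCalculus.IsDivFree v₀) (hc : HasCompactSupport v₀) (s : ℝ) : IsDatum s v₀ :=
  ⟨hs, hdiv, inHs_of_hasCompactSupport hs hc s⟩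

/-! ## E. Bookkeeping -/

/-- `InU` restricts to smaller time sets containing the same initial segments. [folklore] -/
private theorem InU.mono {s : ℝ} {S S' : Set ℝ} {v : ℝ → E3 → E3} (h : InU s S v) (hS : S' ⊆ S) :
    InU s S' v :=
  ⟨fun t ht => h.1 t (hS ht), h.2.1.mono hS, fun T' hT' hsub => h.2.2 T' hT' (hsub.trans hS)⟩

/-- A global solution in `U` restricts to a solution in `U` on every `[0,T)`. [folklore] -/
private theorem IsSolutionOn.restrict {ν s : ℝ} (T : ℝ) {v₀ : E3 → E3} {v : ℝ → E3 → E3}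
    {p : ℝ → E3 → ℝ} (h : IsSolutionOn ν s (Ici 0) v₀ v p) : IsSolutionOn ν s (Ico 0 T) v₀ v p :=
  ⟨h.isClassical.mono Ico_subset_Ici_self (uniqueDiffOn_Ico 0 T), h.initial,
    h.inU.mono Ico_subset_Ici_self⟩

/-- `y(t) ≥ 0`. [folklore] -/
private theorem ySq_nonneg (s : ℝ) (v : ℝ → E3 → E3) (t : ℝ) : 0 ≤ ySq s v t := sq_nonneg _

/-! ## F. Kernel composition -/

/-- Along a solution of the class on `[0,T)`, Steps 3–4 bound `‖v(t)‖_{H^s}` by `√max(y(0), B/A)` on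
`[0,T)` (Step 3 feeds Step 4 with `y = ‖v‖²_{H^s}`; the printed majorant is below `max(y(0), B/A)` by
`majorant_le_max`). [cite: PinheiroQueiroz2025, §6.4–6.6 p.7 l.11–35] -/
theorem hsE_le_of_steps (K : Constants) (h3 : Step3_Riccati K) (h4 : Step4_Majorant K) {ν : ℝ}
    (hν : 0 < ν) {s : ℝ} (hs : 5 / 2 < s) {T : ℝ} {v₀ : E3 → E3} {v : ℝ → E3 → E3} {p : ℝ → E3 → ℝ}
    (hd : IsDatum s v₀) (hS : IsSolutionOn ν s (Ico 0 T) v₀ v p) :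
    ∀ t ∈ Ico 0 T, hsE s (v t) ≤
      ENNReal.ofReal (Real.sqrt (max (ySq s v 0) (K.B ν s / K.A ν s))) := by
  obtain ⟨hcont, hdiff⟩ := h3 ν hν s hs T v₀ v p hd hS
  intro t ht
  have hy : ySq s v t ≤ majorant (K.A ν s) (K.B ν s) (ySq s v 0) t :=
    h4 ν hν s hs (ySq s v) T hcont (fun τ _ => ySq_nonneg s v τ) hdiff t ht
  have hM : ySq s v t ≤ max (ySq s v 0) (K.B ν s / K.A ν s) :=
    hy.trans (majorant_le_max (K.A_pos ν s hν hs) (K.B_pos ν s hν hs) (ySq_nonneg s v 0) ht.1)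
  have hfin : hsE s (v t) < ⊤ := hS.inU.1 t ht
  rw [← ENNReal.ofReal_toReal hfin.ne]
  refine ENNReal.ofReal_le_ofReal ?_
  rw [← Real.sqrt_sq ENNReal.toReal_nonneg]
  exact Real.sqrt_le_sqrt hM

/-- **COMPOSITION** — Steps 1, 3, 4 (with Step 2 the printed support of Step 3, Step 0 the energy clause
used only by the Clay link, Steps S54/7 off the path) imply the claimed statement, for any choice of the
printed constants `K`: Step 1 splits; in the global branch Steps 3–4 give the uniform `H^s` bound on every
`[0,T)`, hence on `[0,∞)`; in the blow-up branch the same bound contradicts the unboundedness of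
`‖v(t)‖_{H^s}` on `[0,T*)` (§6.6, §3.3). [cite: PinheiroQueiroz2025, §§3–6 pp.3–7; §10.1–10.2 pp.11–12] -/
theorem claim_of_steps (K : Constants) (_h0 : Step0_Energy) (_hS54 : Step_S54) (h1 : Step1_LWP)
    (_h2 : Step2_HsIneq K) (h3 : Step3_Riccati K) (h4 : Step4_Majorant K) (_h7 : Step7_InstantReg) :
    ClaimedTheorem := by
  intro ν hν s hs v₀ hd
  rcases h1 ν hν s hs v₀ hd with ⟨v, p, hG⟩ | ⟨Ts, _hTs, v, p, hL, hunb⟩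
  · -- the global branch: the uniform bound on every `[0,t+1)` gives the bound at `t`
    refine ⟨v, p, hG, ?_⟩
    have hy0 : ∀ T : ℝ, ySq s v 0 = ySq s v 0 := fun _ => rfl
    refine lt_of_le_of_lt ?_
      (ENNReal.ofReal_lt_top (r := Real.sqrt (max (ySq s v 0) (K.B ν s / K.A ν s))))
    refine iSup₂_le fun t ht => ?_
    have ht0 : (0 : ℝ) ≤ t := ht
    exact hsE_le_of_steps K h3 h4 hν hs hd (hG.restrict (t + 1)) t ⟨ht0, by linarith⟩
  · -- the blow-up branch is excluded: the bound on `[0,T*)` contradicts unboundedness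
    exfalso
    set M : ℝ := Real.sqrt (max (ySq s v 0) (K.B ν s / K.A ν s))
    obtain ⟨t, ht, hMt⟩ := hunb M
    have hle : hsE s (v t) ≤ ENNReal.ofReal M := hsE_le_of_steps K h3 h4 hν hs hd hL t ht
    have hM0 : 0 ≤ M := Real.sqrt_nonneg _
    have : (hsE s (v t)).toReal ≤ M := by
      have := ENNReal.toReal_mono ENNReal.ofReal_ne_top hle
      rwa [ENNReal.toReal_ofReal hM0] at this
    exact absurd hMt (not_lt.mpr this)

/-! ## G. The Clay link -/

/-- **Clay link** — the claimed statement (existence in `U` for the WIDER printed class, at `s = 3`), the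
printed energy identity (Step 0, supplying Fefferman's (7)) and the data inclusion `ClayDelta` (Δ4) give
Clay (A) (`ClayVariants.clayR3.Regularity`). [cite: FeffermanClay2006, (A) with (1)–(4), (6), (7) pp.1–2]
[cite: PinheiroQueiroz2025, §10.2 p.12 l.19–33; §4.1 p.4 l.47–67] -/
theorem clay_of_claimed (h : ClaimedTheorem) (h0 : Step0_Energy) (hΔ : ClayDelta) :
    ClayVariants.clayR3.Regularity := by
  intro ν hν v₀ hsm hdiv hdec
  obtain ⟨hd, hE0⟩ := hΔ v₀ hsm hdiv hdec
  have h3 : (5 : ℝ) / 2 < 3 := by norm_num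
  obtain ⟨v, p, hG, -⟩ := h ν hν 3 h3 v₀ hd
  obtain ⟨hns, hsu, hsp⟩ :=
    (isNavierStokesSolution_and_smooth_iff (ν := ν) (f := 0) (u₀ := v₀) (u := v) (p := p)).2
      ⟨hG.isClassical, hG.initial⟩
  refine ⟨v, p, hsu, hsp, hns, ?_⟩
  show HasBoundedEnergy v
  refine ⟨∫⁻ x, ‖v₀ x‖ₑ ^ 2, hE0, fun t ht => ?_⟩
  have key := h0 ν hν 3 h3 (t + 1) v₀ v p hd (hG.restrict (t + 1)) t ⟨ht, by linarith⟩
  calc (∫⁻ x, ‖v t x‖ₑ ^ 2)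
      ≤ (∫⁻ x, ‖v t x‖ₑ ^ 2) +
          ENNReal.ofReal (2 * ν) *
            ∫⁻ τ in Ioo 0 t, ∫⁻ x, ENNReal.ofReal (frobeniusNormSq (fderiv ℝ (v τ) x)) := le_self_add
    _ = ∫⁻ x, ‖v₀ x‖ₑ ^ 2 := key

/-! ## H. The Clay delta discharged (keeper ns-claims-lit-4; CLAY-LINK C152) -/

/-- The complexified field `complexify ∘ v₀` of a smooth field of Fefferman's class (4) as a Mathlib Schwartz
map: (4) is exactly Schwartz decay of every derivative (`‖x‖^k ≤ (1+‖x‖)^k`), and the complexification is a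
real linear isometry, so the derivative norms agree (plumbing; same device as the tree's
`FourierNS.schwartzData`). [folklore] [cite: FeffermanClay2006, (4) p.1] -/
private def schwartzOfRapidDecay {v₀ : E3 → E3} (hs : ContDiff ℝ ∞ v₀) (hdec : HasRapidSpatialDecay v₀) :
    𝓢(E3, C3) where
  toFun := Literature.Analysis.FunctionSpaces.EuclideanSpace.complexify ∘ v₀
  smooth' := Literature.Analysis.FunctionSpaces.EuclideanSpace.contDiff_complexify_comp_iff.2 hs
  decay' k n := by
    obtain ⟨C, hC⟩ := hdec n k
    refine ⟨C, fun x => ?_⟩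
    rw [LinearIsometry.norm_iteratedFDeriv_comp_left _ hs.contDiffAt (mod_cast le_top)]
    calc ‖x‖ ^ k * ‖iteratedFDeriv ℝ n v₀ x‖ ≤ (1 + ‖x‖) ^ k * ‖iteratedFDeriv ℝ n v₀ x‖ := by
          gcongr; linarith [norm_nonneg x]
      _ ≤ C := hC x

/-- **Schwartz ⊂ H^s**: a smooth field of class (4) lies in the printed data space `H^s(ℝ³)` for EVERY `s` —
its tempered distribution is that of the Schwartz map `complexify ∘ v₀`, and Schwartz maps lie in every
Sobolev space (Mathlib `SchwartzMap.memSobolev`). [folklore] [cite: BahouriCheminDanchin2011, §1.4.1] -/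
theorem inHs_of_hasRapidSpatialDecay {v₀ : E3 → E3} (hs : ContDiff ℝ ∞ v₀) (hdec : HasRapidSpatialDecay v₀)
    (s : ℝ) : InHs s v₀ := by
  set g : 𝓢(E3, C3) := schwartzOfRapidDecay hs hdec with hg
  refine ⟨(g : 𝓢'(E3, C3)), fun φ => ⟨?_, ?_⟩, g.memSobolev⟩
  · have h1 : Integrable (fun x => φ x) (volume : Measure E3) := φ.integrable
    have h2 : MemLp (fun x => g x) ∞ (volume : Measure E3) := g.memLp ⊤
    exact h1.smul_of_top_left h2
  · rw [SchwartzMap.coe_apply]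
    rfl

/-- **The Clay delta `ClayDelta` HOLDS**: every smooth divergence-free field of Fefferman's class (4) is a
printed datum at the index `s = 3` (indeed at every `s`) and has finite energy (`Dⁿv₀ ∈ L²` for all `n` by
the decay, tree `HasRapidSpatialDecay.lintegral_enorm_iteratedFDeriv_sq_lt_top`, at `n = 0`).
[folklore] [cite: FeffermanClay2006, (4) p.1] [cite: BahouriCheminDanchin2011, §1.4.1] -/
theorem clayDelta_holds : ClayDelta := by
  intro v₀ hs hdiv hdec
  refine ⟨⟨hs, hdiv, inHs_of_hasRapidSpatialDecay hs hdec _⟩, ?_⟩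
  have h0 := hdec.lintegral_enorm_iteratedFDeriv_sq_lt_top (μ := (volume : Measure E3)) 0
  have heq : (fun x => ‖iteratedFDeriv ℝ 0 v₀ x‖ₑ ^ 2) = fun x => ‖v₀ x‖ₑ ^ 2 := by
    funext x
    rw [← ofReal_norm, ← ofReal_norm, norm_iteratedFDeriv_zero]
  rw [heq] at h0
  exact h0

/-- **Clay link with the Δ4 binder discharged**: the claimed statement (existence in `U` for the wider
printed class) and the printed energy identity (Step 0, supplying Fefferman's (7)) give Clay (A); the
remaining extra binder is the paper's own §4.1 step, not a Clay-axis delta.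
[cite: FeffermanClay2006, (A) with (1)–(4), (6), (7) pp.1–2] [cite: PinheiroQueiroz2025, §10.2 p.12 l.19–33; §4.1 p.4 l.47–67] -/
theorem clay_of_claimed' (h : ClaimedTheorem) (h0 : Step0_Energy) : ClayVariants.clayR3.Regularity :=
  clay_of_claimed h h0 clayDelta_holds

/-! ## I. Step 0 discharged; the Clay link binder-free (custodian ns-claims-typist-4 g6, rev 3 — APPEND-ONLY:
every line above is byte-identical to rev 2 p529294; no new import)

D-0026 pass on the TRUE column of C152 (#137; token / class / locator untouched). The printed class `U`
(§3.2) makes `t ↦ ‖v(t)‖_{H^s}` finite and continuous on `[0,T)`, hence bounded on every `[0,t] ⊆ [0,T)`;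
since `‖w‖_{L²} = ‖w‖_{H^0} ≤ ‖w‖_{H^s}` for `s ≥ 0` (Plancherel + monotonicity of the Bessel weight), every
solution of the class is a FINITE-ENERGY classical solution on `[0,t]`, to which the tree's Tao 2013
Lemma 8.1 package applies: it lies in Leray's energy class (`energyClass_of_finiteEnergy`) and satisfies
the SHARP energy equality (`IsClassicalNSSolutionOn.energyEq_of_finiteEnergy`, with Lemma 4.1 (i) and the
`X₅` estimate — all PROVED in `Literature.Analysis.FluidPDE.TaoFiniteEnergyLerayHopf`). This is exactly the
display of Step 0. Consequence: `clayA_of_claimed : ClaimedTheorem → ClayVariants.clayR3.Regularity` with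
NO binder (Step 0 by `step0_Energy_holds`, Δ4 by `clayDelta_holds`). -/

/-- `‖f‖_{H^0} ≤ ‖f‖_{H^s}` on the Fourier side for `s ≥ 0`: the Bessel weight `(1 + ‖ξ‖²)^s ≥ 1`.
[cite: BahouriCheminDanchin2011, §1.4.1] -/
theorem eFourierSobolevNorm_zero_le {s : ℝ} (hs : 0 ≤ s) (f : Lp C3 2 (volume : Measure E3)) :
    Literature.Analysis.FunctionSpaces.eFourierSobolevNorm 0 f ≤
      Literature.Analysis.FunctionSpaces.eFourierSobolevNorm s f := by
  unfold Literature.Analysis.FunctionSpaces.eFourierSobolevNorm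
  refine ENNReal.rpow_le_rpow (lintegral_mono fun ξ => ?_) (by norm_num)
  refine mul_le_mul_left (ENNReal.ofReal_le_ofReal ?_) _
  have h1 : (1 : ℝ) ≤ 1 + ‖ξ‖ ^ 2 := le_add_of_nonneg_right (sq_nonneg _)
  exact Real.rpow_le_rpow_of_exponent_le h1 hs

/-- **`‖w‖²_{L²} ≤ ‖w‖²_{H^s}` for `s ≥ 0`**, at the `[0,∞]` grain of the skeleton: `∫⁻‖w‖ₑ² ≤ (hsE s w)²`
(Plancherel at order `0`, `eFourierSobolevNorm_zero_eq_enorm`; the complexification is norm-preserving,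
`EuclideanSpace.norm_complexify`; both sides are `∞` off `L²`). [cite: BahouriCheminDanchin2011, §1.4.1 and Thm. 1.24] -/
theorem lintegral_enorm_sq_le_hsE_sq {s : ℝ} (hs : 0 ≤ s) (w : E3 → E3) :
    ∫⁻ x, ‖w x‖ₑ ^ 2 ≤ hsE s w ^ 2 := by
  unfold hsE Function.eSobolevNorm
  split_ifs with h
  · have hw : (fun x => ‖w x‖ₑ ^ 2) =
        fun x => ‖(Literature.Analysis.FunctionSpaces.EuclideanSpace.complexify ∘ w) x‖ₑ ^ 2 := by
      funext x
      rw [Function.comp_apply, ← ofReal_norm, ← ofReal_norm,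
        Literature.Analysis.FunctionSpaces.EuclideanSpace.norm_complexify]
    calc ∫⁻ x, ‖w x‖ₑ ^ 2
        = ∫⁻ x, ‖(Literature.Analysis.FunctionSpaces.EuclideanSpace.complexify ∘ w) x‖ₑ ^ 2 := by
          rw [hw]
      _ = eLpNorm (Literature.Analysis.FunctionSpaces.EuclideanSpace.complexify ∘ w) 2 volume ^ 2 := by
          rw [eLpNorm_eq_lintegral_rpow_enorm_toReal two_ne_zero ENNReal.ofNat_ne_top,
            ENNReal.toReal_ofNat, ← ENNReal.rpow_natCast _ 2, ← ENNReal.rpow_mul]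
          norm_num
      _ = Literature.Analysis.FunctionSpaces.eFourierSobolevNorm 0 (h.toLp _) ^ 2 := by
          rw [Literature.Analysis.FunctionSpaces.eFourierSobolevNorm_zero_eq_enorm, Lp.enorm_toLp]
      _ ≤ Literature.Analysis.FunctionSpaces.eFourierSobolevNorm s (h.toLp _) ^ 2 := by
          gcongr
          exact eFourierSobolevNorm_zero_le hs _
  · simp

/-- Along a field in the printed class `U` on `[0,T)`, `∫|v(τ)|²` is bounded on every `[0,t]`, `t < T`
(continuity of `‖v(·)‖_{H^s}` on `[0,T)`, compactness of `[0,t]`, and `L² ⊂ H^s`).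
[cite: PinheiroQueiroz2025, §3.2 p.3 l.41–47] -/
theorem exists_energy_bound_of_inU {s : ℝ} (hs : 0 ≤ s) {T t : ℝ} (ht : t < T) {v : ℝ → E3 → E3}
    (hU : InU s (Ico 0 T) v) :
    ∃ A : ℝ≥0∞, A < ⊤ ∧ ∀ τ ∈ Icc 0 t, ∫⁻ x, ‖v τ x‖ₑ ^ 2 ≤ A := by
  obtain ⟨hfin, hcont, -⟩ := hU
  have hsub : Icc 0 t ⊆ Ico 0 T := Icc_subset_Ico_right ht
  obtain ⟨M, hM⟩ := (isCompact_Icc.image_of_continuousOn (hcont.mono hsub)).isBounded.bddAbove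
  refine ⟨ENNReal.ofReal M ^ 2, ENNReal.pow_lt_top ENNReal.ofReal_lt_top, fun τ hτ => ?_⟩
  refine (lintegral_enorm_sq_le_hsE_sq hs (v τ)).trans ?_
  gcongr
  rw [← ENNReal.ofReal_toReal (hfin τ (hsub hτ)).ne]
  exact ENNReal.ofReal_le_ofReal (hM ⟨τ, hτ, rfl⟩)

/-- **STEP 0 HOLDS** — the energy identity §4.1 p.4 l.47–67,
`‖v(t)‖²_{L²} + 2ν∫₀ᵗ‖∇v(τ)‖²_{L²}dτ = ‖v(0)‖²_{L²}`, along EVERY solution of the printed class `U` on `[0,T)`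
(`s > 5/2`; only `s ≥ 0` is used): such a solution is a finite-energy classical solution on each `[0,t]`,
`t < T` (`exists_energy_bound_of_inU`), hence in Leray's energy class (`energyClass_of_finiteEnergy`:
`∇v ∈ L²_{t,x}`, then `v ∈ L³_{t,x}` by `lintegral_enorm_pow_three_lt_top`), and the tree's sharp energy
equality `IsClassicalNSSolutionOn.energyEq_of_finiteEnergy` (Tao 2013, Lemma 8.1, with Lemma 4.1 (i)
`tao_pressure_normalisation_holds` and the `X₅` estimate `tao2011_pressureTerm_estimate_holds`) gives
`E(v(t)) + ν∫₀ᵗ∫|∇v|² = E(v(0))`; doubling and passing to `[0,∞]` (`eEnergy_eq_ofReal`) is the display.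
At `t = 0` the display is `∫|v₀|² + 0 = ∫|v₀|²`. D-0026 discharge (net debt −1); the binder `_h0` of
`claim_of_steps` and `h0` of `clay_of_claimed` are now fed by this theorem.
[cite: Tao2011, Lemma 8.1 (arXiv:1108.1165, §8)] [cite: PinheiroQueiroz2025, §4–4.1 p.4 l.1–67] -/
theorem step0_Energy_holds : Step0_Energy := by
  intro ν hν s hs T v₀ v p _hd hsol t ht
  rcases ht.1.eq_or_lt with h0 | ht0
  · subst h0
    simp [hsol.initial]
  have hcl : IsClassicalNSSolutionOn (Icc 0 t) ν 0 v p :=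
    hsol.isClassical.mono (Icc_subset_Ico_right ht.2) (uniqueDiffOn_Icc ht0)
  have hfe := exists_energy_bound_of_inU (by linarith : (0 : ℝ) ≤ s) ht.2 hsol.inU
  obtain ⟨A, hAt, hA, -, hgrad⟩ := energyClass_of_finiteEnergy hcl hν ht0 hfe
  have hu₃ := hcl.lintegral_enorm_pow_three_lt_top hAt hA hgrad
  have hid := hcl.energyEq_of_finiteEnergy tao_pressure_normalisation_holds
    tao2011_pressureTerm_estimate_holds hν ht0 hAt hA hgrad hu₃ le_rfl ht0.le le_rfl
  have hmem : ∀ τ ∈ Icc 0 t, MemLp (v τ) 2 volume := fun τ hτ =>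
    memLp_two_of_lintegral_lt_top (hcl.contDiff_velocity hτ).continuous ((hA τ hτ).trans_lt hAt.lt_top)
  have hD : 0 ≤ (∫⁻ τ in Ioo 0 t, ∫⁻ x, ENNReal.ofReal (frobeniusNormSq (fderiv ℝ (v τ) x))).toReal :=
    ENNReal.toReal_nonneg
  rw [← hsol.initial]
  change eEnergy (v t) + _ = eEnergy (v 0)
  rw [eEnergy_eq_ofReal _ (hmem t ⟨ht0.le, le_rfl⟩), eEnergy_eq_ofReal _ (hmem 0 ⟨le_rfl, ht0.le⟩),
    ← ENNReal.ofReal_toReal hgrad.ne, ← ENNReal.ofReal_mul (by positivity),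
    ← ENNReal.ofReal_add (by linarith [kineticEnergy_nonneg (v t)]) (by positivity)]
  congr 1
  linear_combination 2 * hid

/-- **Clay link, BINDER-FREE** — the claimed statement ALONE implies Clay (A): the claimed global solution in
`U` from a Clay datum (taken at `s = 3`, a datum of the printed class by `clayDelta_holds`) has Fefferman's
bounded energy (7) by the now-discharged Step 0 (`step0_Energy_holds`). Supersedes `clay_of_claimed'` for
the records (which keeps its name and statement). [cite: FeffermanClay2006, (A) with (1)–(4), (6), (7) pp.1–2]
[cite: PinheiroQueiroz2025, §10.2 p.12 l.19–33; §4.1 p.4 l.47–67] -/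
theorem clayA_of_claimed (h : ClaimedTheorem) : ClayVariants.clayR3.Regularity :=
  clay_of_claimed h step0_Energy_holds clayDelta_holds

/-! ## J. «Unique» discharged (custodian ns-claims-typist-4 g6, rev 4 — APPEND-ONLY after §I, plus TWO new
imports at the head, `Literature.Analysis.FunctionSpaces.FourierSobolevSupBound` (the `H^s ⊂ L^∞` tool) and
`Literature.Analysis.FluidPDE.NSWeakStrongUniquenessHolds` (Prodi–Serrin); no existing byte changed)

D-0026 pass on the TRUE column of C152 (#137; token / class / locator untouched). `ClaimedUniqueness`
(§10.2 p.12 l.25 «unique», typed for the printed class `U`, `s > 5/2`) is classical weak–strong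
uniqueness: two global solutions of the class from one datum are finite-energy classical solutions on
every `[0,t]` (§I), hence Leray–Hopf weak solutions from `v₀` (Tao 2013 Lemma 8.1,
`isLerayHopfOn_of_finiteEnergy`); the first lies in the Serrin class `L^∞(0,t; L^∞)` because
`H^s(ℝ³) ⊂ L^∞` for `s > 3/2` (tool `ae_enorm_le_mul_eSobolevNorm`, Folland Thm (6.5)) and
`‖v(·)‖_{H^s}` is bounded on `[0,t]`; Prodi–Serrin weak–strong uniqueness (`weak_strong_uniqueness_holds`,
`q = r = ∞`) gives `v'(t) = v(t)` a.e., and both slices are continuous. -/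

/-- Along a field of the printed class `U` on `[0,T)` with `s > 3/2`, the velocity is essentially bounded in
space, uniformly on every `[0,t]`, `t < T`: `‖v(τ,x)‖ ≤ B` for a.e. `x`, every `τ ∈ [0,t]` (Sobolev
`H^s(ℝ³) ⊂ L^∞`, `Literature.Analysis.FunctionSpaces.ae_enorm_le_mul_eSobolevNorm`, with the bound
`sup_{[0,t]}‖v(τ)‖_{H^s}` from the continuity clause of `U`). [cite: Folland1995PDE, §6.A Theorem (6.5)]
[cite: PinheiroQueiroz2025, §3.2 p.3 l.41–47] -/
theorem exists_ae_norm_le_of_inU {s : ℝ} (hs : 3 / 2 < s) {T t : ℝ} (ht : t < T) {v : ℝ → E3 → E3}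
    (hU : InU s (Ico 0 T) v) :
    ∃ B : ℝ, ∀ τ ∈ Icc 0 t, ∀ᵐ x ∂(volume : Measure E3), ‖v τ x‖ ≤ B := by
  obtain ⟨hfin, hcont, -⟩ := hU
  have hsub : Icc 0 t ⊆ Ico 0 T := Icc_subset_Ico_right ht
  obtain ⟨M, hM⟩ := (isCompact_Icc.image_of_continuousOn (hcont.mono hsub)).isBounded.bddAbove
  set C : ℝ≥0∞ := (∫⁻ ξ : E3, ENNReal.ofReal ((1 + ‖ξ‖ ^ 2) ^ (-s))) ^ (1 / 2 : ℝ) with hCdef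
  have hd : (Module.finrank ℝ E3 : ℝ) < 2 * s := by
    rw [finrank_euclideanSpace, Fintype.card_fin]
    push_cast
    linarith
  have hC : C < ⊤ := Literature.Analysis.FunctionSpaces.bessel_const_lt_top hd
  have hCM : C * ENNReal.ofReal M ≠ ⊤ := ENNReal.mul_ne_top hC.ne ENNReal.ofReal_ne_top
  refine ⟨(C * ENNReal.ofReal M).toReal, fun τ hτ => ?_⟩
  have hτ' : τ ∈ Ico 0 T := hsub hτ
  filter_upwards [Literature.Analysis.FunctionSpaces.ae_enorm_le_mul_eSobolevNorm
    (F := C3) hd (Literature.Analysis.FunctionSpaces.EuclideanSpace.complexify ∘ v τ)] with x hx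
  have h1 : ‖v τ x‖ₑ ≤ C * ENNReal.ofReal M := by
    calc ‖v τ x‖ₑ = ‖(Literature.Analysis.FunctionSpaces.EuclideanSpace.complexify ∘ v τ) x‖ₑ := by
          rw [Function.comp_apply, ← ofReal_norm, ← ofReal_norm,
            Literature.Analysis.FunctionSpaces.EuclideanSpace.norm_complexify]
      _ ≤ C * hsE s (v τ) := hx
      _ ≤ C * ENNReal.ofReal M := by
          gcongr
          rw [← ENNReal.ofReal_toReal (hfin τ hτ').ne]
          exact ENNReal.ofReal_le_ofReal (hM ⟨τ, hτ, rfl⟩)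
  rw [← ofReal_norm] at h1
  exact (ENNReal.ofReal_le_iff_le_toReal hCM).1 h1

/-- **«UNIQUE» HOLDS** — `ClaimedUniqueness` (§10.2 p.12 l.25; §9.5 item 1), for the printed class `U` with
`s > 5/2` (only `s > 3/2` is used): weak–strong uniqueness. Both solutions are finite-energy classical
solutions on `[0,t]` (`exists_energy_bound_of_inU`), hence Leray–Hopf weak solutions on `[0,t)` from the
common datum (Tao 2013, Lemma 8.1: `isLerayHopfOn_of_finiteEnergy`); the first is in the Serrin class
`L^∞(0,t; L^∞(ℝ³))` (`exists_ae_norm_le_of_inU` + `memLqLp_of_ae_eLpNorm_le`); Prodi–Serrin weak–strong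
uniqueness in the Leray–Hopf class (`weak_strong_uniqueness_holds`, Serrin 1963 Thm 6 /
Robinson–Rodrigo–Sadowski 2016 Thm 8.19, exponents `q = r = ∞`) gives `v'(t) = v(t)` a.e.; continuous
slices that agree a.e. agree. D-0026 discharge (net debt −1); not on the composition path.
[cite: Serrin1963, Thm. 6] [cite: Tao2011, Lemma 8.1 (arXiv:1108.1165, §8)]
[cite: PinheiroQueiroz2025, §10.2 p.12 l.25–29] -/
theorem claimedUniqueness_holds : ClaimedUniqueness := by
  intro ν hν s hs v₀ _hd v v' p p' hS hS' t ht
  rcases ht.eq_or_lt with h0 | ht0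
  · subst h0
    rw [hS.initial, hS'.initial]
  have hcl : IsClassicalNSSolutionOn (Icc 0 t) ν 0 v p :=
    hS.isClassical.mono Icc_subset_Ici_self (uniqueDiffOn_Icc ht0)
  have hcl' : IsClassicalNSSolutionOn (Icc 0 t) ν 0 v' p' :=
    hS'.isClassical.mono Icc_subset_Ici_self (uniqueDiffOn_Icc ht0)
  have hlt : t < t + 1 := by linarith
  have hs0 : (0 : ℝ) ≤ s := by linarith
  have hfe := exists_energy_bound_of_inU hs0 hlt (hS.restrict (t + 1)).inU
  have hfe' := exists_energy_bound_of_inU hs0 hlt (hS'.restrict (t + 1)).inU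
  have hLH : IsLerayHopfOn t ν 0 v₀ v := by
    have h := (isLerayHopfOn_of_finiteEnergy hcl hν ht0 hfe).1
    rwa [hS.initial] at h
  have hLH' : IsLerayHopfOn t ν 0 v₀ v' := by
    have h := (isLerayHopfOn_of_finiteEnergy hcl' hν ht0 hfe').1
    rwa [hS'.initial] at h
  obtain ⟨B, hB⟩ := exists_ae_norm_le_of_inU (by linarith) hlt (hS.restrict (t + 1)).inU
  have hSer : MemLqLp ⊤ ⊤ v (Ioo 0 t) := by
    refine memLqLp_of_ae_eLpNorm_le (C := ENNReal.ofReal B) ENNReal.ofReal_ne_top ?_ ?_ ?_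
    · rw [Real.volume_Ioo]
      exact ENNReal.ofReal_ne_top
    · exact (ae_restrict_iff' measurableSet_Ioo).2 (Eventually.of_forall fun τ hτ =>
        memLp_top_of_bound (hcl.contDiff_velocity (Ioo_subset_Icc_self hτ)).continuous.aestronglyMeasurable
          B (hB τ (Ioo_subset_Icc_self hτ)))
    · exact (ae_restrict_iff' measurableSet_Ioo).2 (Eventually.of_forall fun τ hτ => by
        rw [eLpNorm_exponent_top]
        exact eLpNormEssSup_le_of_ae_bound (hB τ (Ioo_subset_Icc_self hτ)))
  have hr : (3 : ℝ≥0∞) < ⊤ := by simp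
  have hqr : (2 : ℝ≥0∞) / ⊤ + 3 / ⊤ ≤ 1 := by simp [ENNReal.div_top]
  have hae : v' t =ᵐ[volume] v t :=
    weak_strong_uniqueness_holds hν ht0 hLH hr hqr hSer hLH' t ⟨ht0, le_rfl⟩
  exact ((Continuous.ae_eq_iff_eq (μ := (volume : Measure E3))
    (hcl'.contDiff_velocity ⟨ht0.le, le_rfl⟩).continuous
    (hcl.contDiff_velocity ⟨ht0.le, le_rfl⟩).continuous).1 hae).symm

end

end Literature.Claims.NS.PinheiroQueiroz2025

-- WHAT THIS IS NOT: not a claim about NS regularity or blow-up; not a claim about any author beyond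
-- the typed locator.
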